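import Literature.Analysis.FluidPDE.PassiveVectorTensorWeightedDecay
import Literature.Analysis.FluidPDE.PassiveVectorTensorPropagatorEnergy
import Literature.Analysis.FluidPDE.PassiveVectorTensorPropagatorDuality
import Literature.Analysis.FluidPDE.PassiveScalarForcedTrace
import Literature.Analysis.FluidPDE.DivFreeProjectionFourier
import Literature.Analysis.FunctionSpaces.TorusVectorParseval
import HarnessLib

/-!
# The two-weight dissipation floor AT THE PROPAGATOR LEVEL: `‖U(s,s′)y‖² ≤ ‖y‖² − ½ Σ_k min(1, x_k)·|ŷ(k)|²`

Analysis/FluidPDE file (pure proof layer; no definitions, no named facts).  The flat-class two-weight Lyapunov bound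
(`IsWeakTensorPassiveVectorOn.ae_twoWeight_decay`, an a.e.-in-time statement for one weak solution) is transported to the solution
PROPAGATOR `U` of the linear tensor passive-vector problem (`Torus.IsPropagator T b 𝔸 U`) on a window `[s, s′] ⊆ [0, T]`:
* §1 `IsPropagator.norm_sq_apply_le_half_of_divFree` — for weakly divergence-free `y`,
  `‖U s s′ y‖² ≤ ½ (‖y‖² + Σ_{k∈F} ω_k |ŷ(k)|²)`: the chosen Lions solution `w` on `[s,T)` from `y` (`windowSol`) satisfies the flat bound
  along the shifted carrier; `repr` identifies `U s (s+r) y` with the class of `w r` for a.e. `r`; the endpoint `r = s′ − s` is reached through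
  the weak continuity of `t ↦ U s t y` (`continuousOn`, tested against `U s s′ y` itself; an a.e. inequality between continuous functions holds
  everywhere, `le_on_Icc_of_ae_le_of_continuousOn₂`);
* §2 `IsPropagator.norm_sq_apply_le_half` — the same for EVERY `y ∈ L²` (`U = U ∘ P_σ`, `‖P_σ y‖ ≤ ‖y‖`, and the projection is a modewise
  contraction, `DivFreeProjectionFourier.norm_mFourierCoeff_starProjection_le`);
* §3 `IsPropagator.norm_sq_apply_le_sub_tsum` — Parseval turns it into the DISSIPATION-FLOOR form
  `‖U s s′ y‖² ≤ ‖y‖² − ½ Σ'_k min(1, x_k)·|ŷ(k)|²` for any rates `x_k` with `min(1, x_k) ≤ 1 − ω_k`.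
Hypotheses on the window: `0 ≤ s < s′ ≤ T`; on the carrier: `L^∞`, a.e. weakly divergence free, a.e. continuous and `L`-Lipschitz slices;
on the weight: `0 ≤ ω ≤ 1` supported in `F`, corridor `log 2·(1 − ω_k) ≤ (4/5)·8π²·lo·|k|²·(s′−s)`, flux moment `L·M₃(∇K_ω) ≤ (4/5)·lo`.

Consumer: cell `ad-ideate`, K1L_D `stmt-AnomalousDissipation-27980`, W3-E `stub_effectiveFrameEnergyL` clause (i) for `T = Um s s′`
(crux memo `Lines/onelevel-W3E-k3l-lyapunov.md` §6, P4b); the `T†` case follows with `IsPropagator.adjoint_eq`.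

## Mathlib / tree search
Tree: `IsWeakTensorPassiveVectorOn.ae_twoWeight_decay` (p676954); `windowSol`/`windowSol_spec`, `IsPropagator.repr/continuousOn`,
`isWeaklyDivFree_starProjection` (PassiveVectorTensorPropagator); `IsPropagator.apply_eq_apply_starProjection` (…Unique);
`le_on_Icc_of_ae_le_of_continuousOn₂` (…PropagatorEnergy); `memLp_top_stLift_reversed_window` (…PropagatorDuality), `memLp_top_stLift_reversed`
(…Duality); `ae_restrict_Ioo_comp_add_left` (PassiveScalarForcedTrace); `hasSum_sq_norm_mFourierCoeff_complexify` (TorusVectorParseval).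
Mathlib: `Lp.toLp_coeFn`, `L2.inner_def`, `Submodule.norm_starProjection_apply_le`, `real_inner_self_eq_norm_sq`, `real_inner_le_norm`.

## References
* R. Temam, *Navier–Stokes Equations* (1984), Ch. III §1 Lemma 1.2 (energy inequality), Lemma 1.4 (weak continuity). [`Temam1984`]
* A. Pazy, *Semigroups of Linear Operators* (1983), Ch. 5 §5.1. [`Pazy1983`]
-/

noncomputable section

open MeasureTheory Set Filter Function TopologicalSpace UnitAddTorus
open scoped ENNReal NNReal InnerProductSpace Topology

namespace Literature.Analysis.FluidPDE

namespace Torus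

variable {d : Type*} [Fintype d] [DecidableEq d]
variable {T : ℝ} {𝔸 : Visc4 d} {lo hi : ℝ} {b : ℝ → UnitAddTorus d → EuclideanSpace ℝ d}
variable {U : ℝ → ℝ → (Lp (EuclideanSpace ℝ d) 2 (volume : Measure (UnitAddTorus d)) →L[ℝ]
  Lp (EuclideanSpace ℝ d) 2 (volume : Measure (UnitAddTorus d)))}

omit [DecidableEq d] in
/-- `‖y‖² = ∫ ‖y x‖²` for an `L²` class (file-local). [folklore] -/
private theorem norm_sq_eq_integral (y : Lp (EuclideanSpace ℝ d) 2 (volume : Measure (UnitAddTorus d))) :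
    ‖y‖ ^ 2 = ∫ x, ‖(y : UnitAddTorus d → EuclideanSpace ℝ d) x‖ ^ 2 := by
  rw [← real_inner_self_eq_norm_sq, MeasureTheory.L2.inner_def]
  exact integral_congr_ae (ae_of_all _ fun x => real_inner_self_eq_norm_sq _)

omit [DecidableEq d] in
/-- `‖toLp f‖² = ∫ ‖f x‖²` (file-local). [folklore] -/
private theorem norm_toLp_sq'' {f : UnitAddTorus d → EuclideanSpace ℝ d} (hf : MemLp f 2 volume) :
    ‖hf.toLp f‖ ^ 2 = ∫ x, ‖f x‖ ^ 2 := by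
  rw [norm_sq_eq_integral]
  exact integral_congr_ae (hf.coeFn_toLp.mono fun x hx => by simp only [hx])

omit [DecidableEq d] in
/-- The shifted carrier `r ↦ b (s + r)` is essentially bounded on `(0, T − s) × 𝕋^d` (file-local). [folklore] -/
private theorem memLp_top_stLift_shift
    (hb : MemLp (FunctionSpaces.Torus.stLift b) ∞ (volume.restrict (Ioo 0 T ×ˢ univ))) {s : ℝ} (hs : 0 ≤ s) :
    MemLp (FunctionSpaces.Torus.stLift (fun τ => b (s + τ))) ∞ (volume.restrict (Ioo 0 (T - s) ×ˢ univ)) := by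
  have h := memLp_top_stLift_reversed_window (T := T) (b := b) hb hs le_rfl
  have h2 := memLp_top_stLift_reversed (t₀ := T - s) h le_rfl
  have e : (fun r => -(fun r => -b (T - r)) (T - s - r)) = fun τ => b (s + τ) := by
    funext r; show - -b (T - (T - s - r)) = b (s + r); rw [neg_neg]; congr 1; ring
  rw [e] at h2
  exact h2

namespace IsPropagator

/-! ## §1 Divergence-free data -/

/-- **Two-weight floor for the propagator, divergence-free data**: `‖U s s′ y‖² ≤ ½ (‖y‖² + Σ_{k∈F} ω_k |ŷ(k)|²)`.
[cite: Temam1984, Ch. III §1 Lemma 1.2] -/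
theorem norm_sq_apply_le_half_of_divFree (hU : IsPropagator T b 𝔸 U) (h𝔸 : NearIso 𝔸 lo hi) (hlo : 0 < lo)
    (hb : MemLp (FunctionSpaces.Torus.stLift b) ∞ (volume.restrict (Ioo 0 T ×ˢ univ)))
    (hbdiv : ∀ᵐ τ ∂(volume.restrict (Ioo 0 T)), FunctionSpaces.Torus.IsWeaklyDivFree (b τ))
    (hbc : ∀ᵐ τ ∂(volume.restrict (Ioo 0 T)), Continuous (b τ))
    {L : ℝ} (hL0 : 0 ≤ L)
    (hbL : ∀ᵐ τ ∂(volume.restrict (Ioo 0 T)), ∀ x y, ‖b τ x - b τ y‖ ≤ L * ‖FunctionSpaces.Torus.reprc (x - y)‖)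
    {s s' : ℝ} (hs : 0 ≤ s) (hss' : s < s') (hs'T : s' ≤ T)
    (F : Finset (d → ℤ)) (ω : (d → ℤ) → ℝ) (hωF : ∀ k, k ∉ F → ω k = 0) (hω0 : ∀ k, 0 ≤ ω k) (hω1 : ∀ k, ω k ≤ 1)
    (hωlo : ∀ k, Real.log 2 * (1 - ω k) ≤ 4 / 5 * (8 * Real.pi ^ 2 * lo * FunctionSpaces.Torus.freqNormSq k * (s' - s)))
    (hM : L * (∫ z, ‖FunctionSpaces.Torus.reprc z‖ ^ 3 * ∑ a, |FunctionSpaces.Torus.fluxKernelGrad F ω a z|) ≤ 4 / 5 * lo)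
    (y : Lp (EuclideanSpace ℝ d) 2 (volume : Measure (UnitAddTorus d)))
    (hy : FunctionSpaces.Torus.IsWeaklyDivFree (y : UnitAddTorus d → EuclideanSpace ℝ d)) :
    ‖U s s' y‖ ^ 2 ≤ 1 / 2 * (‖y‖ ^ 2 +
      ∑ k ∈ F, ω k * ‖mFourierCoeff (FunctionSpaces.EuclideanSpace.complexify ∘ (y : UnitAddTorus d → EuclideanSpace ℝ d)) k‖ ^ 2) := by
  have hsT : s < T := hss'.trans_le hs'T
  set τ : ℝ := s' - s with hτdef
  have hτ : 0 < τ := sub_pos.2 hss'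
  have hτT : τ ≤ T - s := by rw [hτdef]; linarith
  have hym : MemLp (y : UnitAddTorus d → EuclideanSpace ℝ d) 2 volume := Lp.memLp y
  set w := windowSol h𝔸 hlo hb hbdiv hs hsT hym hy with hwdef
  have hsol := windowSol_spec h𝔸 hlo hb hbdiv hs hsT hym hy
  -- the shifted carrier
  have hb' := memLp_top_stLift_shift (T := T) hb hs
  have hbc' : ∀ᵐ r ∂(volume.restrict (Ioo 0 (T - s))), Continuous (b (s + r)) :=
    ae_restrict_Ioo_comp_add_left (P := fun t => Continuous (b t)) hbc hs (by linarith)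
  have hbL' : ∀ᵐ r ∂(volume.restrict (Ioo 0 (T - s))), ∀ x y, ‖b (s + r) x - b (s + r) y‖ ≤
      L * ‖FunctionSpaces.Torus.reprc (x - y)‖ :=
    ae_restrict_Ioo_comp_add_left (P := fun t => ∀ x y, ‖b t x - b t y‖ ≤ L * ‖FunctionSpaces.Torus.reprc (x - y)‖) hbL hs
      (by linarith)
  -- the flat two-weight bound along `w`
  have hflat := hsol.ae_twoWeight_decay h𝔸 hlo hym hy hb' hbc' hL0 hbL' hτ hτT F ω hωF hω0 hω1 hωlo hM
  -- representation of `U` by `w`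
  have hrepr := hU.repr s hs hsT _ hym hy w hsol
  have hyLp : hym.toLp (y : UnitAddTorus d → EuclideanSpace ℝ d) = y := Lp.toLp_coeFn y hym
  set R : ℝ := 1 / 2 * (‖y‖ ^ 2 +
      ∑ k ∈ F, ω k * ‖mFourierCoeff (FunctionSpaces.EuclideanSpace.complexify ∘ (y : UnitAddTorus d → EuclideanSpace ℝ d)) k‖ ^ 2)
    with hRdef
  have hR0 : 0 ≤ R :=
    mul_nonneg (by norm_num) (add_nonneg (sq_nonneg _) (Finset.sum_nonneg fun k _ => mul_nonneg (hω0 k) (sq_nonneg _)))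
  -- a.e. `r ∈ (0, τ)`: `½ e^{log 2 · r/τ} ‖U s (s+r) y‖² ≤ R`
  have hsub : Ioo 0 τ ⊆ Ioo 0 (T - s) := Ioo_subset_Ioo le_rfl hτT
  have hgood : ∀ᵐ r ∂(volume.restrict (Ioo 0 τ)), ‖U s (s + r) y‖ ^ 2 ≤ 2 * Real.exp (-(Real.log 2 * r / τ)) * R := by
    filter_upwards [hflat, ae_restrict_of_ae_restrict_of_subset hsub hrepr, ae_restrict_mem measurableSet_Ioo]
      with r hr hrep hrI
    obtain ⟨hm, he⟩ := hrep
    rw [hyLp] at he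
    have e1 : ‖U s (s + r) y‖ ^ 2 = ∫ x, ‖w r x‖ ^ 2 := by rw [← he]; exact norm_toLp_sq'' hm
    have hexp : Real.exp (Real.log 2 * r / τ) ≤ 2 := by
      have h1 : Real.log 2 * r / τ ≤ Real.log 2 := by
        rw [div_le_iff₀ hτ]
        have := Real.log_pos (show (1:ℝ) < 2 by norm_num)
        nlinarith [hrI.2.le]
      calc Real.exp (Real.log 2 * r / τ) ≤ Real.exp (Real.log 2) := Real.exp_le_exp.2 h1
        _ = 2 := Real.exp_log (by norm_num)
    have hnn : 0 ≤ (1 - 1 / 2 * Real.exp (Real.log 2 * r / τ)) *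
        ∑ k ∈ F, ω k * ‖mFourierCoeff (FunctionSpaces.EuclideanSpace.complexify ∘ w r) k‖ ^ 2 :=
      mul_nonneg (by linarith) (Finset.sum_nonneg fun k _ => mul_nonneg (hω0 k) (sq_nonneg _))
    have hE0 : (∫ x, ‖(y : UnitAddTorus d → EuclideanSpace ℝ d) x‖ ^ 2) = ‖y‖ ^ 2 := (norm_sq_eq_integral y).symm
    rw [hE0] at hr
    have h2 : 1 / 2 * Real.exp (Real.log 2 * r / τ) * ‖U s (s + r) y‖ ^ 2 ≤ R := by rw [e1, hRdef]; linarith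
    have hpos : 0 < Real.exp (Real.log 2 * r / τ) := Real.exp_pos _
    rw [Real.exp_neg]
    rw [← div_le_iff₀' (by positivity)] at h2 ⊢
    · calc ‖U s (s + r) y‖ ^ 2 / (2 * (Real.exp (Real.log 2 * r / τ))⁻¹)
          = 1 / 2 * Real.exp (Real.log 2 * r / τ) * ‖U s (s + r) y‖ ^ 2 := by field_simp
        _ ≤ R := by rw [e1, hRdef]; linarith
  -- the endpoint through weak continuity, tested against `U s s' y`
  set A : ℝ := ‖U s s' y‖ with hAdef
  have hA0 : 0 ≤ A := norm_nonneg _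
  set f : ℝ → ℝ := fun r => ⟪U s (s + r) y, U s s' y⟫_ℝ with hfdef
  set g : ℝ → ℝ := fun r => Real.sqrt (2 * Real.exp (-(Real.log 2 * r / τ)) * R) * A with hgdef
  have hfc : ContinuousOn f (Icc 0 τ) := by
    have hc := hU.continuousOn s hs hsT.le y (U s s' y)
    refine (hc.comp (continuous_const.add continuous_id).continuousOn ?_)
    intro r hr
    exact ⟨by linarith [hr.1], by rw [hτdef] at hr; linarith [hr.2]⟩
  have hgc : ContinuousOn g (Icc 0 τ) := by
    refine ((Real.continuous_sqrt.comp ?_).mul continuous_const).continuousOn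
    exact (continuous_const.mul (Real.continuous_exp.comp ((continuous_const.mul continuous_id).div_const _).neg)).mul
      continuous_const
  have hfg : ∀ᵐ r ∂(volume.restrict (Ioo 0 τ)), f r ≤ g r := by
    filter_upwards [hgood] with r hr
    have h1 : f r ≤ ‖U s (s + r) y‖ * A := real_inner_le_norm _ _
    have h2 : ‖U s (s + r) y‖ ≤ Real.sqrt (2 * Real.exp (-(Real.log 2 * r / τ)) * R) := by
      rw [← Real.sqrt_sq (norm_nonneg _)]
      exact Real.sqrt_le_sqrt hr
    exact h1.trans (mul_le_mul_of_nonneg_right h2 hA0)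
  have hend := le_on_Icc_of_ae_le_of_continuousOn₂ hτ hfc hgc hfg τ ⟨hτ.le, le_rfl⟩
  have hfτ : f τ = A ^ 2 := by
    simp only [hfdef, hτdef, add_sub_cancel, hAdef]
    exact real_inner_self_eq_norm_sq _
  have hgτ : g τ = Real.sqrt R * A := by
    simp only [hgdef]
    rw [mul_div_assoc, div_self hτ.ne', mul_one, Real.exp_neg, Real.exp_log (by norm_num : (0:ℝ) < 2)]
    norm_num
  rw [hfτ, hgτ] at hend
  -- `A² ≤ √R · A` ⇒ `A² ≤ R`
  rcases hA0.eq_or_lt with hA | hApos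
  · rw [← hA]; simpa using hR0
  · have h3 : A ≤ Real.sqrt R := by
      have : A * A ≤ Real.sqrt R * A := by rw [← sq]; exact hend
      exact le_of_mul_le_mul_right this hApos
    calc A ^ 2 ≤ Real.sqrt R ^ 2 := by gcongr
      _ = R := Real.sq_sqrt hR0

/-! ## §2 All data -/

/-- **Two-weight floor for the propagator, all `L²` data**: `‖U s s′ y‖² ≤ ½ (‖y‖² + Σ_{k∈F} ω_k |ŷ(k)|²)` (`U` factors through `P_σ`, which
is a contraction and a modewise contraction). [cite: Temam1984, Ch. III §1 Lemma 1.2] -/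
theorem norm_sq_apply_le_half (hU : IsPropagator T b 𝔸 U) (h𝔸 : NearIso 𝔸 lo hi) (hlo : 0 < lo)
    (hb : MemLp (FunctionSpaces.Torus.stLift b) ∞ (volume.restrict (Ioo 0 T ×ˢ univ)))
    (hbdiv : ∀ᵐ τ ∂(volume.restrict (Ioo 0 T)), FunctionSpaces.Torus.IsWeaklyDivFree (b τ))
    (hbc : ∀ᵐ τ ∂(volume.restrict (Ioo 0 T)), Continuous (b τ))
    {L : ℝ} (hL0 : 0 ≤ L)
    (hbL : ∀ᵐ τ ∂(volume.restrict (Ioo 0 T)), ∀ x y, ‖b τ x - b τ y‖ ≤ L * ‖FunctionSpaces.Torus.reprc (x - y)‖)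
    {s s' : ℝ} (hs : 0 ≤ s) (hss' : s < s') (hs'T : s' ≤ T)
    (F : Finset (d → ℤ)) (ω : (d → ℤ) → ℝ) (hωF : ∀ k, k ∉ F → ω k = 0) (hω0 : ∀ k, 0 ≤ ω k) (hω1 : ∀ k, ω k ≤ 1)
    (hωlo : ∀ k, Real.log 2 * (1 - ω k) ≤ 4 / 5 * (8 * Real.pi ^ 2 * lo * FunctionSpaces.Torus.freqNormSq k * (s' - s)))
    (hM : L * (∫ z, ‖FunctionSpaces.Torus.reprc z‖ ^ 3 * ∑ a, |FunctionSpaces.Torus.fluxKernelGrad F ω a z|) ≤ 4 / 5 * lo)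
    (y : Lp (EuclideanSpace ℝ d) 2 (volume : Measure (UnitAddTorus d))) :
    ‖U s s' y‖ ^ 2 ≤ 1 / 2 * (‖y‖ ^ 2 +
      ∑ k ∈ F, ω k * ‖mFourierCoeff (FunctionSpaces.EuclideanSpace.complexify ∘ (y : UnitAddTorus d → EuclideanSpace ℝ d)) k‖ ^ 2) := by
  set P := (divFreeL2 d).starProjection with hP
  rw [hU.apply_eq_apply_starProjection s s' y]
  have h := hU.norm_sq_apply_le_half_of_divFree h𝔸 hlo hb hbdiv hbc hL0 hbL hs hss' hs'T F ω hωF hω0 hω1 hωlo hM (P y)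
    (isWeaklyDivFree_starProjection y)
  refine h.trans ?_
  have h1 : ‖P y‖ ≤ ‖y‖ := (divFreeL2 d).norm_starProjection_apply_le y
  have h2 : ∀ k ∈ F, ω k * ‖mFourierCoeff (FunctionSpaces.EuclideanSpace.complexify ∘
        ((P y : Lp (EuclideanSpace ℝ d) 2 (volume : Measure (UnitAddTorus d))) : UnitAddTorus d → EuclideanSpace ℝ d)) k‖ ^ 2 ≤
      ω k * ‖mFourierCoeff (FunctionSpaces.EuclideanSpace.complexify ∘ (y : UnitAddTorus d → EuclideanSpace ℝ d)) k‖ ^ 2 :=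
    fun k _ => mul_le_mul_of_nonneg_left (pow_le_pow_left₀ (norm_nonneg _) (norm_mFourierCoeff_starProjection_le y k) 2) (hω0 k)
  have hS := Finset.sum_le_sum h2
  have hN : ‖P y‖ ^ 2 ≤ ‖y‖ ^ 2 := pow_le_pow_left₀ (norm_nonneg _) h1 2
  linarith

/-! ## §3 The dissipation-floor form -/

omit [DecidableEq d] in
/-- Parseval bookkeeping: `½(‖y‖² + Σ_{k∈F} ω_k|ŷ_k|²) ≤ ‖y‖² − ½ Σ'_k min(1,x_k)|ŷ_k|²` whenever `min(1, x_k) ≤ 1 − ω_k` for all `k` and `ω`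
vanishes off `F`. [cite: Temam1984, Ch. III §1 Lemma 1.2] -/
theorem half_add_sum_le_sub_tsum (F : Finset (d → ℤ)) (ω : (d → ℤ) → ℝ) (hωF : ∀ k, k ∉ F → ω k = 0)
    (x : (d → ℤ) → ℝ) (hx0 : ∀ k, 0 ≤ x k) (hx : ∀ k, min 1 (x k) ≤ 1 - ω k)
    (y : Lp (EuclideanSpace ℝ d) 2 (volume : Measure (UnitAddTorus d))) :
    1 / 2 * (‖y‖ ^ 2 +
        ∑ k ∈ F, ω k * ‖mFourierCoeff (FunctionSpaces.EuclideanSpace.complexify ∘ (y : UnitAddTorus d → EuclideanSpace ℝ d)) k‖ ^ 2) ≤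
      ‖y‖ ^ 2 - 1 / 2 * ∑' k : d → ℤ, min 1 (x k) *
        ‖mFourierCoeff (FunctionSpaces.EuclideanSpace.complexify ∘ (y : UnitAddTorus d → EuclideanSpace ℝ d)) k‖ ^ 2 := by
  classical
  set c : (d → ℤ) → ℝ := fun k =>
    ‖mFourierCoeff (FunctionSpaces.EuclideanSpace.complexify ∘ (y : UnitAddTorus d → EuclideanSpace ℝ d)) k‖ ^ 2 with hc
  have hpar : HasSum c (‖y‖ ^ 2) := by
    rw [norm_sq_eq_integral]
    exact FunctionSpaces.Torus.hasSum_sq_norm_mFourierCoeff_complexify (Lp.memLp y)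
  have hc0 : ∀ k, 0 ≤ c k := fun k => sq_nonneg _
  have hωsum : HasSum (fun k => ω k * c k) (∑ k ∈ F, ω k * c k) :=
    hasSum_sum_of_ne_finset_zero fun k hk => by rw [hωF k hk, zero_mul]
  have h1ω : HasSum (fun k => (1 - ω k) * c k) (‖y‖ ^ 2 - ∑ k ∈ F, ω k * c k) := by
    have h := hpar.sub hωsum
    refine h.congr_fun fun k => ?_
    ring
  have hmin : Summable fun k => min 1 (x k) * c k :=
    Summable.of_nonneg_of_le (fun k => mul_nonneg (le_min zero_le_one (hx0 k)) (hc0 k))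
      (fun k => mul_le_of_le_one_left (hc0 k) (min_le_left _ _)) hpar.summable
  have hle : ∑' k, min 1 (x k) * c k ≤ ‖y‖ ^ 2 - ∑ k ∈ F, ω k * c k := by
    rw [← h1ω.tsum_eq]
    exact (hmin.tsum_le_tsum (fun k => mul_le_mul_of_nonneg_right (hx k) (hc0 k)) h1ω.summable)
  show 1 / 2 * (‖y‖ ^ 2 + ∑ k ∈ F, ω k * c k) ≤ ‖y‖ ^ 2 - 1 / 2 * ∑' k, min 1 (x k) * c k
  linarith

/-- **THE DISSIPATION FLOOR OF THE PROPAGATOR**: under the hypotheses of `norm_sq_apply_le_half` and for rates `x_k ≥ 0` with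
`min(1, x_k) ≤ 1 − ω_k`, `‖U s s′ y‖² ≤ ‖y‖² − ½ Σ'_k min(1, x_k)·|ŷ(k)|²` for every `y ∈ L²`. [cite: Temam1984, Ch. III §1 Lemma 1.2] -/
theorem norm_sq_apply_le_sub_tsum (hU : IsPropagator T b 𝔸 U) (h𝔸 : NearIso 𝔸 lo hi) (hlo : 0 < lo)
    (hb : MemLp (FunctionSpaces.Torus.stLift b) ∞ (volume.restrict (Ioo 0 T ×ˢ univ)))
    (hbdiv : ∀ᵐ τ ∂(volume.restrict (Ioo 0 T)), FunctionSpaces.Torus.IsWeaklyDivFree (b τ))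
    (hbc : ∀ᵐ τ ∂(volume.restrict (Ioo 0 T)), Continuous (b τ))
    {L : ℝ} (hL0 : 0 ≤ L)
    (hbL : ∀ᵐ τ ∂(volume.restrict (Ioo 0 T)), ∀ x y, ‖b τ x - b τ y‖ ≤ L * ‖FunctionSpaces.Torus.reprc (x - y)‖)
    {s s' : ℝ} (hs : 0 ≤ s) (hss' : s < s') (hs'T : s' ≤ T)
    (F : Finset (d → ℤ)) (ω : (d → ℤ) → ℝ) (hωF : ∀ k, k ∉ F → ω k = 0) (hω0 : ∀ k, 0 ≤ ω k) (hω1 : ∀ k, ω k ≤ 1)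
    (hωlo : ∀ k, Real.log 2 * (1 - ω k) ≤ 4 / 5 * (8 * Real.pi ^ 2 * lo * FunctionSpaces.Torus.freqNormSq k * (s' - s)))
    (hM : L * (∫ z, ‖FunctionSpaces.Torus.reprc z‖ ^ 3 * ∑ a, |FunctionSpaces.Torus.fluxKernelGrad F ω a z|) ≤ 4 / 5 * lo)
    (x : (d → ℤ) → ℝ) (hx0 : ∀ k, 0 ≤ x k) (hx : ∀ k, min 1 (x k) ≤ 1 - ω k)
    (y : Lp (EuclideanSpace ℝ d) 2 (volume : Measure (UnitAddTorus d))) :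
    ‖U s s' y‖ ^ 2 ≤ ‖y‖ ^ 2 - 1 / 2 * ∑' k : d → ℤ, min 1 (x k) *
        ‖mFourierCoeff (FunctionSpaces.EuclideanSpace.complexify ∘ (y : UnitAddTorus d → EuclideanSpace ℝ d)) k‖ ^ 2 :=
  (hU.norm_sq_apply_le_half h𝔸 hlo hb hbdiv hbc hL0 hbL hs hss' hs'T F ω hωF hω0 hω1 hωlo hM y).trans
    (half_add_sum_le_sub_tsum F ω hωF x hx0 hx y)

end IsPropagator

end Torus

end Literature.Analysis.FluidPDE

end
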